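import Summits.QuantumFields.YangMills.Theorems.FluctuationComparisonRegPrIntLS2BetaRelativeTowerSupProfile
import HarnessLib

/-!
# S2β · the (D♮) REL-TEL road — THE STAGE TOWER'S SUP PROFILE OVER A GENERAL (NON-FLAT) TOP:
# px17 g19's ✓`exists_supProfile_relativeTower` with the hypothesis `U′_m = 1` REMOVED — the profile STARTS at the bond size of the top field
# (`s m ≤ σ` whenever every bond arc of `U′_m` is `≤ σ`), the conditional quadratic step is unchanged

Cell `ym3-torus` (YM ladder rung R3 = continuum `SU(2)` Yang–Mills on the three-torus — a RUNG: NOT d = 4, NOT infinite volume, NOT a mass gap,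
NOT Clay).  Width seat «width 12» `ym3-torus-px12` (gen 24), FREE px helper on crux `stmt-QuantumFields-20520`
(`Theses.UnitScaleTilt.FluctuationComparisonRegPrIntL`); `--kind proof --supports stmt-QuantumFields-20520 --as helper`, count-neutral, DEFINITION-FREE
(0 `def`, 0 `instance`, 0 `notation`, 0 `sorry`, default heartbeats).

WHY (UV3-NODE §84.3∕§84.4, this seat).  The two stage towers of the (D♮) road stand over the DATUM `V` (`U′_{K−J} = U′₀_{K−J}` = the datum in the trivial
top gauge), not over `1` as in the `hFlat` road; so the sup profile feeding the chart letter (L♭) (✓∕⧗ `…S2BetaChartLetterOfSupProfile`) and the SIZE slots of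
(H♭) starts at `σ := max_b arc(V b)` — the datum's bond size IN ITS GAUGE (✓p822838 `…S2BetaDatumGaugeWLOG`) — instead of `0`.  px17's proof uses `htop`
ONLY for the conjunct `s m = 0`; the profile (the bondwise maximum of the arcs, level by level) and the conditional quadratic step
`s (t+1) ≤ 1∕4 → s t ≤ L⁻¹·s (t+1) + ρ t + C₂·s (t+1)²` (✓`arc_le_sup_step_hatLift`) are top-agnostic.  THIS FILE re-runs that proof without `htop`:
★★★ `exists_supProfile_relativeTower_start` — same hypotheses minus `htop`, same conclusions with `s m = 0` replaced by «`s m ≤ σ` for every `σ` bounding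
the top's arcs».  With this seat's ✓∕⧗ `…S2BetaContractingSupStart.sq_budget_of_start` (the bootstrap from a start `σ ≤ M`, `C₂M ≤ (1 − L⁻¹)∕2`,
`Σρ ≤ (1 − L⁻¹)M∕2`) the square budget `Σ_{t<m} s_{t+1}² ≤ M·(…)` follows — DEPTH-FREE from an O(1) start.

HONEST SCOPE.  A re-run of a landed proof with one hypothesis removed; nothing of Bałaban's analysis is asserted ([Balaban1985RegularSpaces] Lemma 1
(1.24)–(1.26) p.79, (1.65) p.87: local axial-gauge sizes; [Balaban1987RG1] (0.4) p.253); the T³ reading (thresholds `θBal`, the `γ₁`), the datum's small-bond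
gauge (`σ ≤ M ≈ (1 − L⁻¹)∕(2C₂)`, `C₂ = 12π(L² − 1)∕L²` at `d = 3`), (L♭)'s assembly, (H♭), (D♮), GAP♯∘, S2β, crux 20520 and `YM3TorusSU2` are NOT proved;
no registered stub is closed; rung R3 = SU(2) YM₃ on T³ — NOT d = 4, NOT infinite volume, NOT a mass gap, NOT Clay; the Yang–Mills mass gap is NOT proved.
-/

set_option autoImplicit false

noncomputable section

namespace Summit.QuantumFields.YangMills.Theorems.FluctuationComparisonRegPrIntLS2BetaRelativeTowerSupProfileStart

open Finset
open scoped Real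
open Literature.MathematicalPhysics.QuantumLattice (su2Quat)
open Literature.MathematicalPhysics.QuantumFieldTheory.Balaban1983to89
open T4Continuum BlockAveraging
open B10Eq27TorusAxialLog (rel axialT)
open T4CubeChartGnomonic (SU2)
open T4HaarSU2ExpChart (expPoint)
open T4ExpWindowSmallField (logVec)
open Summit.QuantumFields.YangMills.Theorems.FluctuationComparisonRegPrIntLS2BetaRelativeTowerSupProfile (arc_le_sup_step_hatLift)

variable {P : Params}

/-- ★★★ **THE STAGE TOWER'S SUP PROFILE FROM A GENERAL TOP** (px17 g19's ✓`exists_supProfile_relativeTower` without `U′_m = 1`): heights `t ≤ m ≤ m_P + K_P`;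
`U′_t` the gauged levels, `V_t` the hat lift of `U′_{t+1}` (formulas `hw`, `hV`), (T4) comb axiality of `U′_t` relative to `V_t`, (T5) `U′_t` averages to
`U′_{t+1}`; plaquettes of `U′_t` `θ_t`-small inside the `ℰp` guard.  Then the bondwise-maximum profile `s` has: `0 ≤ s`; `arc (U′_t b) ≤ s t` (`t ≤ m`);
the START `s m ≤ σ` for every `σ` bounding the top's arcs; and the CONDITIONAL QUADRATIC STEP for `t < m`: if `s (t+1) ≤ 1∕4` then
`s t ≤ L⁻¹·s (t+1) + ρ t + C₂·s (t+1)²` with px17's `ρ`, `C₂`. [cite: Balaban1985RegularSpaces, Lemma 1 (1.24)-(1.26) p.79, (1.65) p.87; Balaban1987RG1, (0.4) p.253] -/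
theorem exists_supProfile_relativeTower_start {m : ℕ} (hm : m ≤ P.m + P.K)
    (U' : (t : ℕ) → GaugeField P t SU2) (w : (t : ℕ) → PBond P t → PBond P (t + 1) → ℝ) (V : (t : ℕ) → GaugeField P t SU2)
    (hw : ∀ t, t < m → ∀ b e, w t b e = if e.dir = b.dir ∧ (b.src b.dir - emb e.src b.dir).val < P.L then
      ∏ ν ∈ Finset.univ.erase b.dir, max 0 (1 - ((rel (emb e.src) b.src ν).natAbs : ℝ) / P.L) else 0)
    (hV : ∀ t, t < m → ∀ b, V t b = expPoint (∑ e, w t b e • ((P.L : ℝ)⁻¹ • logVec (su2Quat (U' (t + 1) e)))))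
    (hax : ∀ t, t < m → ∀ z : Site P t, axialT (U' t) (emb (blockOf z)) z = axialT (V t) (emb (blockOf z)) z)
    (hT5 : ∀ t, t < m → avgFun T3UnitLawDensityEML.ℰp (U' t) = U' (t + 1))
    (θ : ℕ → ℝ) (hθ0 : ∀ t, 0 ≤ θ t) (hθ : ∀ t, t ≤ m → PlaqSmall (θ t) (U' t))
    (hg1 : ∀ t, t < m → ((((P.d + 2) * P.L : ℕ) : ℝ) ^ 2 / 4) * θ t < ExpMeanLog.deltaSU (Fin 2))
    (hg2 : ∀ t, t < m → ((((P.d + 2) * P.L : ℕ) : ℝ) ^ 2 / 4) * θ t ≤ 1 / 6) :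
    ∃ s : ℕ → ℝ, (∀ σ : ℝ, (∀ b : PBond P m, ‖logVec (su2Quat (U' m b))‖ ≤ σ) → s m ≤ σ) ∧ (∀ t, 0 ≤ s t) ∧
      (∀ t, t ≤ m → ∀ b : PBond P t, ‖logVec (su2Quat (U' t b))‖ ≤ s t) ∧
      ∀ t, t < m → s (t + 1) ≤ 1 / 4 →
        s t ≤ (P.L : ℝ)⁻¹ * s (t + 1) +
          π / 2 * (((((P.d - 1) * ((P.L - 1) / 2) * (P.L + 1) : ℕ) : ℝ) + 2 * ((((P.d + 2) * P.L : ℕ) : ℝ) ^ 2 / 4)) * θ t +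
            (((P.d - 1) * ((P.L - 1) / 2) * (P.L + 1) : ℕ) : ℝ) * ((P.L : ℝ)⁻¹) ^ 2 * (π / 2) * θ (t + 1)) +
          π / 2 * (((P.d - 1) * ((P.L - 1) / 2) * (P.L + 1) : ℕ) : ℝ) * 24 * ((P.L : ℝ)⁻¹) ^ 2 * s (t + 1) ^ 2 := by
  classical
  have hne : ∀ t, (Finset.univ : Finset (PBond P t)).Nonempty := fun t => ⟨⟨default, ⟨0, P.hd⟩⟩, Finset.mem_univ _⟩
  -- the profile: the bondwise maximum at heights ≤ m, zero above
  refine ⟨fun t => if t ≤ m then (Finset.univ : Finset (PBond P t)).sup' (hne t) (fun b => ‖logVec (su2Quat (U' t b))‖) else 0, ?_, ?_, ?_, ?_⟩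
  · -- the start: the top's arcs
    intro σ hσ
    simp only [le_refl, if_true]
    exact Finset.sup'_le _ _ fun b _ => hσ b
  · -- nonnegativity
    intro t
    by_cases ht : t ≤ m
    · simp only [ht, if_true]
      obtain ⟨b₀, hb₀⟩ := hne t
      exact (norm_nonneg _).trans (Finset.le_sup' (fun b => ‖logVec (su2Quat (U' t b))‖) hb₀)
    · simp only [ht, if_false, le_refl]
  · -- the profile bounds the arcs
    intro t ht b
    simp only [ht, if_true]
    exact Finset.le_sup' (fun b => ‖logVec (su2Quat (U' t b))‖) (Finset.mem_univ b)
  · -- the conditional quadratic step (✓`arc_le_sup_step_hatLift`, verbatim from px17's proof)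
    intro t ht hs4
    have ht' : t ≤ m := ht.le
    have ht1 : t + 1 ≤ m := ht
    simp only [ht', ht1, if_true] at hs4 ⊢
    have htt : t + 1 ≤ P.m + P.K := by omega
    refine Finset.sup'_le _ _ fun b _ => ?_
    have hstep := arc_le_sup_step_hatLift htt (w t) (hw t ht) (U' (t + 1)) (V t) (hV t ht) (U' t) (hax t ht) (hT5 t ht)
      (hθ0 t) (hθ t ht') (hg1 t ht) (hg2 t ht) (hθ0 (t + 1)) (fun q => (hθ (t + 1) ht1 q).le)
      (fun e => Finset.le_sup' (fun e => ‖logVec (su2Quat (U' (t + 1) e))‖) (Finset.mem_univ e)) hs4 b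
    refine hstep.trans (le_of_eq ?_)
    ring

end Summit.QuantumFields.YangMills.Theorems.FluctuationComparisonRegPrIntLS2BetaRelativeTowerSupProfileStart

end
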